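import Literature.MathematicalPhysics.QuantumFieldTheory.Balaban1983to89.HaarExpChartChangeOfVariablesPiMeasure

/-!
# `Balaban1983to89.HaarExpChartChangeOfVariablesPiInverse` — [Balaban1985UV3] (18) ∕ [Helgason2000] (13) on a window READ
# RIGHT-TO-LEFT: a flat integral `∫_T φ d(⊗η)` over a coordinate window `T ⊆ B(0,s)^B` as an integral over `Θ^B(T)` (or
# `Θ^B(T)·U₀`) against the product Haar measure `⊗μ` with the weight `1 / Π_b |det jac(Λ U_b)|`, and the measure form
# `(Θ^B)_*((⊗η)|_T) = σ₀^{−|B|} • (Π_b |det jac(Λ U_b)|)⁻¹ · (⊗μ)|_{Θ^B T}` — the COARSE-SIDE step of assembling a fibred chart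
# (flat fibre coordinates, then back to the product Haar measure of the coarse bond variables)

statement-level skeleton of published theorems with citation tags; proofs where landed; nothing here is a claim
about the Yang–Mills mass gap

Cell `pub-ymgap`, seat `pub-ymgap-dag-n09-w4` (gen 4; node N09, helper lane of the K1⁷ item, count-neutral).  File 5 of the (F1)
group-chart composition (files 1–4: `HaarExpChartChangeOfVariables{,Pi,PiMeasure}`, `FieldMeasureExpChartChangeOfVariables`).  WHY: a
«fibred chart» identity `dU|_{avg⁻¹ D ∩ S} = Φ_*(J · (dV|_D ⊗ τ))` ([Balaban1987RG1] (2.10) p. 267 read without δ-functions) is assembled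
from (i) the fine window in coordinates (file 2∕3), (ii) a flat straightening of the fibres (Mathlib's change of variables on
`B → 𝔤`), (iii) the coarse coordinates pushed BACK to `dV` — step (iii) is this file.  SETTING = file 3's; `Λ^B U = (Λ U_b)_b`.

CONTENT (theorems only; 0 def, 0 instance, 0 sorry; axioms standard).
* §1 **`lintegral_pi_haar_image_div_eq`** — `∫_{Θ^B T} φ(Λ^B U) / Π_b|det jac(Λ U_b)| d(⊗μ) = σ₀^{|B|} · ∫_T φ d(⊗η)` for every
  `φ : (B → 𝔤) → ℝ≥0∞`, `T ⊆ B(0,s)^B` Borel with `det jac(X_b) ≠ 0` on `T`; **`lintegral_pi_haar_translate_image_div_eq`** — the same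
  over `Θ^B(T)·U₀` with `Λ^B(U·U₀⁻¹)` (`μ` right invariant).
* §2 **`map_piChart_restrict_eq_smul_withDensity`** — `(Θ^B)_*((⊗η)|_T) = (σ₀^{|B|})⁻¹ • (U ↦ (Π_b |det jac(Λ U_b)|)⁻¹) · (⊗μ)|_{Θ^B T}`
  (file 2's window identity tested against measurable integrands); `map_piChart_translate_restrict_eq_smul_map_withDensity` — the same
  pushed forward under the bond-wise right translation by `U₀`; `map_withDensity_measurableEquiv` ((g·M).map e = (g∘e⁻¹)·(M.map e)) and
  **`map_piChart_translate_restrict_eq_smul_withDensity`** — the translated window in weighted-restriction form (`μ` right invariant).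

HONEST SCOPE.  Standard measure theory over p28's chart; nothing of Bałaban's asserted or estimated; no chart of Bałaban's constructed;
`σ₀` is p28's window constant (for `SU(N)`: `1/∫_{alcove}|det jac| dη`, file 4); nothing of p28 ∕ files 1–4 ∕ Mathlib re-proved.
-/

noncomputable section

open NormedSpace Set Function Filter Topology MeasureTheory
open scoped ENNReal NNReal

namespace Literature.MathematicalPhysics.QuantumFieldTheory.Balaban1983to89.HaarExponentialChart

namespace IsChartRep

open B13HaarSigmaJacobian (jac)

variable {𝔸 : Type*} [NormedRing 𝔸] [NormedAlgebra ℂ 𝔸] [CompleteSpace 𝔸]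
variable {G : Type*} [Group G] [TopologicalSpace G] [IsTopologicalGroup G] [CompactSpace G]
variable {C : LogChart 𝔸} {ρ : G →* 𝔸} (h : IsChartRep C ρ) [FiniteDimensional ℝ C.lie]
  (hlie : ∀ x ∈ C.lie, ∀ y ∈ C.lie, x * y - y * x ∈ C.lie)
variable [MeasurableSpace C.lie] [BorelSpace C.lie] (η : Measure C.lie) [η.IsAddHaarMeasure]
variable [MeasurableSpace G] [BorelSpace G] (μ : Measure G) [μ.IsHaarMeasure]
variable (B : Type*) [Fintype B]

omit [IsTopologicalGroup G] [CompactSpace G] [FiniteDimensional ℝ C.lie] [MeasurableSpace C.lie] [BorelSpace C.lie]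
  [MeasurableSpace G] [BorelSpace G] [Fintype B] in
/-- On `B(0,s)^B`, `s ≤ s_C`, the bond-wise logarithmic chart inverts the bond-wise exponential chart: `Λ(Θ X_b) = X_b`.
[cite: Helgason2000, Ch. I §1 Thm. 1.14 (13) p. 96 (bookkeeping)] -/
theorem logChart_expChart_of_mem_pi_ball {s : ℝ} (hs : s ≤ chartRadius C) {X : B → C.lie}
    (hX : X ∈ Set.pi Set.univ fun _ => Metric.ball (0 : C.lie) s) (b : B) :
    h.logChart (h.expChart (X b)) = X b :=
  h.logChart_expChart (lt_of_lt_of_le (mem_ball_zero_iff.1 (hX b (Set.mem_univ b))) hs)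

omit [CompleteSpace 𝔸] [IsTopologicalGroup G] [CompactSpace G] [MeasurableSpace C.lie] [BorelSpace C.lie]
  [MeasurableSpace G] [BorelSpace G] in
/-- The product density `Π_b |det jac(X_b)|` is neither `0` nor `∞` where `det jac(X_b) ≠ 0` for every `b`.
[cite: Helgason2000, Ch. I §1 Thm. 1.14 (12) p. 96 (bookkeeping)] -/
theorem prod_jacDensity_ne_zero_and_ne_top {X : B → C.lie}
    (hjac : ∀ b, LinearMap.det (jac hlie (X b) : C.lie →ₗ[ℝ] C.lie) ≠ 0) :
    ∏ b, jacDensity hlie (X b) ≠ 0 ∧ ∏ b, jacDensity hlie (X b) ≠ ∞ := by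
  refine ⟨Finset.prod_ne_zero_iff.2 fun b _ => ?_, ENNReal.prod_ne_top fun b _ => ?_⟩
  · rw [jacDensity_def]
    exact fun h0 => hjac b (abs_eq_zero.1 (ENNReal.ofReal_eq_zero.1 h0 |>.antisymm (abs_nonneg _)))
  · rw [jacDensity_def]; exact ENNReal.ofReal_ne_top

/-! ## §1 Flat integrals over a window as integrals against the product Haar measure -/

/-- **(18) READ RIGHT-TO-LEFT**: for `0 < s ≤ s_C`, a Borel `T ⊆ B(0,s)^B` on which `det jac(X_b) ≠ 0` for every `b`, and every
`φ : (B → 𝔤) → ℝ≥0∞`:  `∫_{Θ^B T} φ(Λ^B U) / Π_b |det jac(Λ U_b)| d(⊗μ)(U) = σ₀^{|B|} · ∫_T φ d(⊗η)` — a flat integral over the coordinate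
window is an integral against the product Haar measure of the bond variables with the weight `1/Π|det jac ∘ Λ|`.
[cite: Balaban1985UV3, (18) p. 260] [cite: Helgason2000, Ch. I §1 Thm. 1.14 (13) p. 96] -/
theorem lintegral_pi_haar_image_div_eq {s : ℝ} (hs0 : 0 < s) (hs : s ≤ chartRadius C)
    {T : Set (B → C.lie)} (hT : MeasurableSet T) (hTs : T ⊆ Set.pi Set.univ fun _ => Metric.ball (0 : C.lie) s)
    (hjac : ∀ X ∈ T, ∀ b, LinearMap.det (jac hlie (X b) : C.lie →ₗ[ℝ] C.lie) ≠ 0) (φ : (B → C.lie) → ℝ≥0∞) :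
    ∫⁻ U in (fun (A : B → C.lie) (b : B) => h.expChart (A b)) '' T,
        φ (fun b => h.logChart (U b)) / ∏ b, jacDensity hlie (h.logChart (U b)) ∂(Measure.pi fun _ : B => μ) =
      (μ (h.window s) / h.chartMeasure hlie η s (h.window s)) ^ Fintype.card B * ∫⁻ X in T, φ X ∂(Measure.pi fun _ : B => η) := by
  rw [h.lintegral_pi_haar_image_eq hlie η μ B hs0 hs Metric.isOpen_ball.measurableSet (h.injOn_expChart hs) hT hTs]
  congr 1
  refine setLIntegral_congr_fun hT fun X hX => ?_
  obtain ⟨hj0, hjtop⟩ := prod_jacDensity_ne_zero_and_ne_top hlie B (hjac X hX)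
  simp only [h.logChart_expChart_of_mem_pi_ball B hs (hTs hX)]
  rw [ENNReal.div_mul_cancel hj0 hjtop]

/-- **THE SAME OVER A TRANSLATED WINDOW** (`μ` right invariant, any `U₀ ∈ G^B`):
`∫_{Θ^B(T)·U₀} φ(Λ^B(U·U₀⁻¹)) / Π_b |det jac(Λ(U_b U₀(b)⁻¹))| d(⊗μ)(U) = σ₀^{|B|} · ∫_T φ d(⊗η)`.
[cite: Balaban1985UV3, (18) p. 260] [cite: Helgason2000, Ch. I §1 Thm. 1.14 (13) p. 96] -/
theorem lintegral_pi_haar_translate_image_div_eq [μ.IsMulRightInvariant] {s : ℝ} (hs0 : 0 < s) (hs : s ≤ chartRadius C)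
    {T : Set (B → C.lie)} (hT : MeasurableSet T) (hTs : T ⊆ Set.pi Set.univ fun _ => Metric.ball (0 : C.lie) s)
    (hjac : ∀ X ∈ T, ∀ b, LinearMap.det (jac hlie (X b) : C.lie →ₗ[ℝ] C.lie) ≠ 0) (U₀ : B → G)
    (φ : (B → C.lie) → ℝ≥0∞) :
    ∫⁻ U in (fun (U : B → G) (b : B) => U b * U₀ b) '' ((fun (A : B → C.lie) (b : B) => h.expChart (A b)) '' T),
        φ (fun b => h.logChart (U b * (U₀ b)⁻¹)) / ∏ b, jacDensity hlie (h.logChart (U b * (U₀ b)⁻¹))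
          ∂(Measure.pi fun _ : B => μ) =
      (μ (h.window s) / h.chartMeasure hlie η s (h.window s)) ^ Fintype.card B * ∫⁻ X in T, φ X ∂(Measure.pi fun _ : B => η) := by
  have hmp : MeasurePreserving (fun (U : B → G) (b : B) => U b * U₀ b) (Measure.pi fun _ : B => μ) (Measure.pi fun _ : B => μ) :=
    measurePreserving_mul_right (Measure.pi fun _ : B => μ) U₀
  have hemb : MeasurableEmbedding (fun (U : B → G) (b : B) => U b * U₀ b) := (MeasurableEquiv.mulRight U₀).measurableEmbedding
  rw [← hmp.setLIntegral_comp_emb hemb]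
  simp only [mul_inv_cancel_right]
  exact h.lintegral_pi_haar_image_div_eq hlie η μ B hs0 hs hT hTs hjac φ

/-! ## §2 The measure form: `(Θ^B)_*((⊗η)|_T)` as a weighted restriction of `⊗μ` -/

/-- **THE COORDINATE MEASURE OF A WINDOW PUSHED TO THE GROUP**: for `0 < s ≤ s_C` and a Borel `T ⊆ B(0,s)^B` on which `det jac(X_b) ≠ 0`:
`(Θ^B)_*((⊗η)|_T) = (σ₀^{|B|})⁻¹ • (U ↦ (Π_b |det jac(Λ U_b)|)⁻¹) · (⊗μ)|_{Θ^B T}` — file 2's window identity with the density moved to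
the group side and inverted (tested against measurable integrands). [cite: Balaban1985UV3, (18) p. 260] [cite: Helgason2000, Ch. I §1 Thm. 1.14 (13) p. 96] -/
theorem map_piChart_restrict_eq_smul_withDensity {s : ℝ} (hs0 : 0 < s) (hs : s ≤ chartRadius C)
    {T : Set (B → C.lie)} (hT : MeasurableSet T) (hTs : T ⊆ Set.pi Set.univ fun _ => Metric.ball (0 : C.lie) s)
    (hjac : ∀ X ∈ T, ∀ b, LinearMap.det (jac hlie (X b) : C.lie →ₗ[ℝ] C.lie) ≠ 0) :
    ((Measure.pi fun _ : B => η).restrict T).map (fun (A : B → C.lie) (b : B) => h.expChart (A b)) =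
      ((μ (h.window s) / h.chartMeasure hlie η s (h.window s)) ^ Fintype.card B)⁻¹ •
        ((Measure.pi fun _ : B => μ).restrict ((fun (A : B → C.lie) (b : B) => h.expChart (A b)) '' T)).withDensity
          (fun U => (∏ b, jacDensity hlie (h.logChart (U b)))⁻¹) := by
  have hΩ : MeasurableSet (Metric.ball (0 : C.lie) s) := Metric.isOpen_ball.measurableSet
  have hc := h.windowConst_ne_zero_and_ne_top hlie η μ hs0 hs
  have hcB0 : (μ (h.window s) / h.chartMeasure hlie η s (h.window s)) ^ Fintype.card B ≠ 0 := pow_ne_zero _ hc.1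
  have hcBtop : (μ (h.window s) / h.chartMeasure hlie η s (h.window s)) ^ Fintype.card B ≠ ∞ := ENNReal.pow_ne_top hc.2
  -- the product density pulled back to the group side is a.e.-measurable on `Θ^B T`
  have hdens : Measurable fun A : B → C.lie => ∏ b, jacDensity hlie (A b) :=
    Finset.measurable_prod _ fun b _ => (measurable_jacDensity hlie).comp (measurable_pi_apply b)
  have hDm : AEMeasurable (fun U : B → G => ∏ b, jacDensity hlie (h.logChart (U b)))
      ((Measure.pi fun _ : B => μ).restrict ((fun (A : B → C.lie) (b : B) => h.expChart (A b)) '' T)) := by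
    refine h.aemeasurable_pi_restrict_image_of_comp_piChart hlie η μ B hs0 hs hΩ (h.injOn_expChart hs) hT hTs ?_
    refine hdens.aemeasurable.congr ((ae_restrict_mem hT).mono fun X hX => ?_)
    simp only [Function.comp_apply, h.logChart_expChart_of_mem_pi_ball B hs (hTs hX)]
  -- test against measurable integrands: both sides integrate `f` to `∫_T f(Θ^B A) d(⊗η)`
  have hΘB : Measurable (fun (A : B → C.lie) (b : B) => h.expChart (A b)) :=
    measurable_pi_lambda _ fun b => h.measurable_expChart.comp (measurable_pi_apply b)
  have hDm' : AEMeasurable (fun U : B → G => (∏ b, jacDensity hlie (h.logChart (U b)))⁻¹)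
      ((Measure.pi fun _ : B => μ).restrict ((fun (A : B → C.lie) (b : B) => h.expChart (A b)) '' T)) := hDm.inv
  refine Measure.ext_of_lintegral _ fun f hf => ?_
  rw [lintegral_map hf hΘB, lintegral_smul_measure, lintegral_withDensity_eq_lintegral_mul₀ hDm' hf.aemeasurable,
    h.lintegral_pi_haar_image_eq hlie η μ B hs0 hs hΩ (h.injOn_expChart hs) hT hTs, smul_eq_mul, ← mul_assoc,
    ENNReal.inv_mul_cancel hcB0 hcBtop, one_mul]
  refine setLIntegral_congr_fun hT fun X hX => ?_
  obtain ⟨hj0, hjtop⟩ := prod_jacDensity_ne_zero_and_ne_top hlie B (hjac X hX)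
  simp only [Pi.mul_apply, h.logChart_expChart_of_mem_pi_ball B hs (hTs hX)]
  set D := ∏ b, jacDensity hlie (X b)
  set fX := f fun b => h.expChart (X b)
  symm
  calc D⁻¹ * fX * D = fX * (D⁻¹ * D) := by ring
    _ = fX := by rw [ENNReal.inv_mul_cancel hj0 hjtop, mul_one]

/-- **THE SAME AT A TRANSLATED WINDOW, as a push-forward**: `(A ↦ Θ^B(A)·U₀)_*((⊗η)|_T) = (σ₀^{|B|})⁻¹ • (U ↦ U·U₀)_*((Π_b|det jac(Λ U_b)|)⁻¹ · (⊗μ)|_{Θ^B T})`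
(the previous identity pushed forward under the bond-wise right translation; with `μ` right invariant the right-hand side lives on `Θ^B(T)·U₀`).
[cite: Balaban1985UV3, (18) p. 260] [cite: Helgason2000, Ch. I §1 Thm. 1.14 (13) p. 96] -/
theorem map_piChart_translate_restrict_eq_smul_map_withDensity {s : ℝ} (hs0 : 0 < s) (hs : s ≤ chartRadius C)
    {T : Set (B → C.lie)} (hT : MeasurableSet T) (hTs : T ⊆ Set.pi Set.univ fun _ => Metric.ball (0 : C.lie) s)
    (hjac : ∀ X ∈ T, ∀ b, LinearMap.det (jac hlie (X b) : C.lie →ₗ[ℝ] C.lie) ≠ 0) (U₀ : B → G) :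
    ((Measure.pi fun _ : B => η).restrict T).map (fun (A : B → C.lie) (b : B) => h.expChart (A b) * U₀ b) =
      ((μ (h.window s) / h.chartMeasure hlie η s (h.window s)) ^ Fintype.card B)⁻¹ •
        (((Measure.pi fun _ : B => μ).restrict ((fun (A : B → C.lie) (b : B) => h.expChart (A b)) '' T)).withDensity
          (fun U => (∏ b, jacDensity hlie (h.logChart (U b)))⁻¹)).map (fun (U : B → G) (b : B) => U b * U₀ b) := by
  haveI : T2Space G := h.isClosedEmbedding.isEmbedding.t2Space
  have hΘB : Measurable (fun (A : B → C.lie) (b : B) => h.expChart (A b)) :=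
    measurable_pi_lambda _ fun b => h.measurable_expChart.comp (measurable_pi_apply b)
  have he : Measurable (fun (U : B → G) (b : B) => U b * U₀ b) := (MeasurableEquiv.mulRight U₀).measurable
  have hcomp : (fun (A : B → C.lie) (b : B) => h.expChart (A b) * U₀ b) =
      (fun (U : B → G) (b : B) => U b * U₀ b) ∘ fun (A : B → C.lie) (b : B) => h.expChart (A b) := rfl
  rw [hcomp, ← Measure.map_map he hΘB, h.map_piChart_restrict_eq_smul_withDensity hlie η μ B hs0 hs hT hTs hjac,
    Measure.map_smul]

omit [CompleteSpace 𝔸] [IsTopologicalGroup G] [CompactSpace G] [FiniteDimensional ℝ C.lie] [MeasurableSpace C.lie]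
  [BorelSpace C.lie] [BorelSpace G] [Fintype B] in
/-- Push-forward of a weighted measure under a measurable equivalence: `(g · M).map e = (g ∘ e⁻¹) · (M.map e)` (no measurability of `g` needed).
[cite: Helgason2000, Ch. I §1 Thm. 1.14 (13) p. 96 (bookkeeping)] -/
theorem map_withDensity_measurableEquiv {X : Type*} [MeasurableSpace X] (M : Measure X) (e : X ≃ᵐ X) (g : X → ℝ≥0∞) :
    (M.withDensity g).map e = (M.map e).withDensity (g ∘ e.symm) := by
  refine Measure.ext fun A hA => ?_
  rw [e.map_apply, withDensity_apply _ (e.measurable hA), withDensity_apply _ hA, e.measurableEmbedding.restrict_map,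
    e.measurableEmbedding.lintegral_map]
  exact lintegral_congr fun x => by simp only [Function.comp_apply, e.symm_apply_apply]

/-- **THE COORDINATE MEASURE OF A TRANSLATED WINDOW AS A WEIGHTED RESTRICTION OF `⊗μ`** (`μ` right invariant, any `U₀ ∈ G^B`):
`(A ↦ Θ^B(A)·U₀)_*((⊗η)|_T) = (σ₀^{|B|})⁻¹ • (U ↦ (Π_b |det jac(Λ(U_b·U₀(b)⁻¹))|)⁻¹) · (⊗μ)|_{Θ^B(T)·U₀}` — the coarse side of a fibred chart
centred at an arbitrary configuration, pushed back to the product Haar measure of the bond variables.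
[cite: Balaban1985UV3, (18) p. 260] [cite: Helgason2000, Ch. I §1 Thm. 1.14 (13) p. 96] -/
theorem map_piChart_translate_restrict_eq_smul_withDensity [μ.IsMulRightInvariant] {s : ℝ} (hs0 : 0 < s)
    (hs : s ≤ chartRadius C) {T : Set (B → C.lie)} (hT : MeasurableSet T)
    (hTs : T ⊆ Set.pi Set.univ fun _ => Metric.ball (0 : C.lie) s)
    (hjac : ∀ X ∈ T, ∀ b, LinearMap.det (jac hlie (X b) : C.lie →ₗ[ℝ] C.lie) ≠ 0) (U₀ : B → G) :
    ((Measure.pi fun _ : B => η).restrict T).map (fun (A : B → C.lie) (b : B) => h.expChart (A b) * U₀ b) =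
      ((μ (h.window s) / h.chartMeasure hlie η s (h.window s)) ^ Fintype.card B)⁻¹ •
        ((Measure.pi fun _ : B => μ).restrict
            ((fun (U : B → G) (b : B) => U b * U₀ b) '' ((fun (A : B → C.lie) (b : B) => h.expChart (A b)) '' T))).withDensity
          (fun U => (∏ b, jacDensity hlie (h.logChart (U b * (U₀ b)⁻¹)))⁻¹) := by
  let e : (B → G) ≃ᵐ (B → G) := MeasurableEquiv.mulRight U₀
  have he : (fun (U : B → G) (b : B) => U b * U₀ b) = e := rfl
  have hinv : (Measure.pi fun _ : B => μ).map e = Measure.pi fun _ : B => μ :=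
    MeasureTheory.map_mul_right_eq_self (Measure.pi fun _ : B => μ) U₀
  have hM : (Measure.pi fun _ : B => μ).restrict (e '' ((fun (A : B → C.lie) (b : B) => h.expChart (A b)) '' T)) =
      ((Measure.pi fun _ : B => μ).restrict ((fun (A : B → C.lie) (b : B) => h.expChart (A b)) '' T)).map e := by
    conv_lhs => rw [← hinv]
    rw [e.measurableEmbedding.restrict_map, e.injective.preimage_image]
  have hdens : (fun U : B → G => (∏ b, jacDensity hlie (h.logChart (U b * (U₀ b)⁻¹)))⁻¹) =
      (fun U : B → G => (∏ b, jacDensity hlie (h.logChart (U b)))⁻¹) ∘ e.symm := by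
    funext U
    simp only [Function.comp_apply, e, MeasurableEquiv.symm_mulRight, MeasurableEquiv.coe_mulRight, Pi.mul_apply, Pi.inv_apply]
  rw [h.map_piChart_translate_restrict_eq_smul_map_withDensity hlie η μ B hs0 hs hT hTs hjac U₀, he, hM, hdens,
    map_withDensity_measurableEquiv]

end IsChartRep

end Literature.MathematicalPhysics.QuantumFieldTheory.Balaban1983to89.HaarExponentialChart
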